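import Summits.ResolutionOfSingularities.ResolutionOfSingularities.Theorems.FrobeniusClosingPatchingRelPerfectSliceOfEngine
import Summits.ResolutionOfSingularities.ResolutionOfSingularities.Theorems.PAlterationPialtAtomsOpenRange
import Literature.AlgebraicGeometry.Resolution.ZariskiPatchingProperModels
import Literature.AlgebraicGeometry.Resolution.ProperModelsJoin
import Literature.AlgebraicGeometry.Resolution.AffineDomainDimension
import Literature.AlgebraicGeometry.Resolution.QuasiExcellentSchemes
import Literature.AlgebraicGeometry.Resolution.ExcellentRingsFieldProofs
import Literature.AlgebraicGeometry.Resolution.Principalization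
import Mathlib.RingTheory.EssentialFiniteness
import HarnessLib

/-!
# Crux `PatchingPerfect` (stmt-ResolutionOfSingularities-16089), line `birth` (v5):
# stub `stub_sliceAllDim` (E3) — LU over `k` and multi-roof gluing resolve every variety over `k`

Routes `ResolutionOfSingularities/IndSmooth` and `ResolutionOfSingularities/AbhyankarShadows`, crux
`PatchingPerfect` (Zariski's patching over ONE field `k`). This file proves the registered stub
`stub_sliceAllDim` of the line `birth` (skeleton v5), verbatim, in ALL dimensions: relative local
uniformization over `k` (`hLU`) together with the MULTI-ROOF GLUING (`hR`, the conclusion of the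
neighbouring stub E2 `stub_multiRoofGluing`: an integral separated finite-type `k`-scheme `N`
carrying finitely many proper birational dominations `q i : N → N' i`, `dim N' i ≤ d`, under which
every point of `N` has SOME regular image, has a resolution) imply that every integral separated
`k`-scheme of finite type has a resolution of singularities (`Scheme.HasResolution`).

## Proof (Zariski 1944, Fundamental Theorem p. 539; Piltant 2013, Prop. 5.1 and Cor. 5.7, with
the iterated join and the multi-roof gluing in place of the patching of two models)

This is `Theorems.stub_sliceOfEngine` / `hasResolution_projective_of_dim_le_four` of the sibling
crux `PatchingRelPerfect` WITHOUT the dimension case split and without Cossart–Piltant: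

* reduction to integral closed subschemes `X ⊆ ℙⁿ_k` (`ResolutionOverUpToDim.of_projective`:
  components, Chow's lemma, projective closure), at `d ≥ dim X`
  (`exists_topologicalKrullDim_le_of_locallyOfFiniteType`);
* an affine chart `Spec A ∋ η` of `X`, `K = Frac A`, `X` as the projective model `M₀` of `K/k`
  (`ProjModel.ofChart`); `trdeg_k K = m ∈ ℕ` (`exists_ringKrullDim_eq_and_trdeg_eq`);
* (LU) at `k` in the fibrewise shape gives a finite resolving system `𝒯` of affine models
  (`exists_hasRegularCentre_of_relLU`, `exists_finite_resolvingSystem'`), pushed to proper models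
  `M T`, `T ∈ 𝒯` (`ProjModel.exists_regCentre_of_hasRegularCentre`, `ProjModel.toProperModel`);
* the iterated JOIN `N` of `M₀` with the `M T`
  (`PatchingRelPerfect.SliceOfEngine.exists_hom_forall_nonempty_hom`) dominates `M₀` and every
  `M T`; CHOOSE dominations `φ T : N → M T` (proper, birational: `ProperModel.Hom.isProper`,
  `ProperModel.Hom.isBirational`); `dim (M T) = trdeg_k K = m`
  (`Pialt.OpenRange.properModel_topologicalKrullDim_eq_of_trdeg`);
* COVERING: every point `x ∈ N` is the centre of a valuation ring `v` of `K/k`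
  (`KModel.exists_isCentre_of_isGenericPoint`), regularly centred on some `M T`, and `φ T` maps
  `x` to the centre of `v` on `M T` (`ProperModel.Hom.map_centre`), a regular point;
* `hR` (at `d = m`, index type `↥𝒯`) resolves `N`; transfer along the proper birational
  domination `N → M₀ = X` (`Scheme.HasResolution.of_isBirational`).

## References

* O. Zariski, *Reduction of the singularities of algebraic three dimensional varieties*, Ann. of
  Math. 45 (1944) 472–542, Fundamental Theorem p. 539. [Zariski1944]
* O. Piltant, *An axiomatic version of Zariski's patching theorem*, RACSAM 107 (2013) 91–121,
  Prop. 5.1 and Cor. 5.7. [Piltant2013]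
* O. Zariski, P. Samuel, *Commutative Algebra* II, Ch. VI §17. [ZariskiSamuel1960]
-/

set_option linter.dupNamespace false -- single-problem summit: doubled namespace component is forced

noncomputable section

open CategoryTheory CategoryTheory.Limits AlgebraicGeometry Literature.AlgebraicGeometry.Resolution
open Literature.AlgebraicGeometry (Motives.projectiveSpace Motives.isProper_projectiveSpace
  Motives.IsProjectiveOver)
open TopologicalSpace IsLocalRing

namespace Summit.ResolutionOfSingularities.ResolutionOfSingularities.Theorems

namespace PatchingPerfect.SliceAllDim

open PatchingRelPerfect.SliceOfEngine (exists_hom_forall_nonempty_hom)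

/-- **The projective integral case of the all-dimensional slice.** For a field `k` with relative
local uniformization over `k` (fibrewise shape `hLU`) and the multi-roof gluing over `k` (`hR`),
every integral closed subscheme `X ⊆ ℙⁿ_k` has a resolution of singularities. Zariski's setup
verbatim (`hasResolution_projective_of_dim_le_four`, no dimension split): affine chart
`Spec A ∋ η`, `K = Frac A`, `X` as the projective model `M₀ = ProjModel.ofChart …`,
`trdeg_k K = m`; a finite resolving system `𝒯` of proper models `M T` from (LU); the iterated join
`N` of `M₀` with the `M T`, with chosen dominations `φ T : N → M T` (proper, birational,
`dim (M T) = m`); every point of `N` is the centre of a valuation ring, regularly centred on some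
`M T`, and `φ T` maps centres to centres, so `hR` resolves `N`; the resolution descends along the
proper birational domination `N → X`. [cite: Piltant2013, Prop. 5.1 and Cor. 5.7]
[cite: Zariski1944, p. 539] -/
theorem hasResolution_projective {k : Type} [Field k]
    (hLU : ∀ (K : Type) [Field K] [Algebra k K] (O : ValuationSubring K) (R : Subalgebra k K),
      R.FG → IsFractionRing R K → R.toSubring ≤ O.toSubring →
        ∃ (A : Subalgebra k K) (h : A.toSubring ≤ O.toSubring), R ≤ A ∧ A.FG ∧
          IsRegularLocalRing (Localization.AtPrime
            (Ideal.comap (Subring.inclusion h) (IsLocalRing.maximalIdeal O))))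
    (hR : ∀ (d : ℕ) (N : Scheme.{0}) (gN : N ⟶ Spec (.of k)) [IsSeparated gN]
      [LocallyOfFiniteType gN] [QuasiCompact gN] [IsIntegral N] (ι : Type) [Finite ι]
      (N' : ι → Scheme.{0}) (g' : (i : ι) → (N' i ⟶ Spec (.of k)))
      [∀ i, LocallyOfFiniteType (g' i)] [∀ i, QuasiCompact (g' i)] [∀ i, IsIntegral (N' i)],
      (∀ i, topologicalKrullDim (N' i) ≤ d) →
      ∀ (q : (i : ι) → (N ⟶ N' i)) [∀ i, IsProper (q i)], (∀ i, IsBirational (q i)) →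
        (∀ n : N, ∃ i, IsRegularLocalRing ((N' i).presheaf.stalk ((q i).base n))) →
        Scheme.HasResolution N)
    {n : ℕ} (X : Scheme.{0}) [IsIntegral X] (ι : X ⟶ (Motives.projectiveSpace n k).left)
    [IsClosedImmersion ι] : Scheme.HasResolution X := by
  classical
  haveI : IsProper (Motives.projectiveSpace n k).hom := Motives.isProper_projectiveSpace n k
  let πX : X ⟶ Spec (.of k) := ι ≫ (Motives.projectiveSpace n k).hom
  have hproj : Motives.IsProjectiveOver (Over.mk πX) := ⟨n, Over.homMk ι rfl, ‹_›⟩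
  haveI : LocallyOfFiniteType πX := inferInstance
  -- an affine chart `U = Spec A` of `X`
  obtain ⟨_, ⟨U', hU', rfl⟩, hηU, -⟩ := X.isBasis_affineOpens.exists_subset_of_mem_open
    (Set.mem_univ (genericPoint X)) isOpen_univ
  let U : X.Opens := U'
  have hU : IsAffineOpen U := hU'
  haveI : IsAffine U := hU
  haveI : Nonempty U := ⟨⟨_, hηU⟩⟩
  let A : Type := Γ(U, ⊤)
  -- `A` is a finitely generated `k`-algebra
  let g : (U : Scheme.{0}) ⟶ Spec (.of k) := U.ι ≫ πX
  let ψ : k →+* A := g.appTop.hom.comp (Scheme.ΓSpecIso (.of k)).inv.hom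
  have hψ : ψ.FiniteType := by
    have h1 : g.appTop.hom.FiniteType :=
      (HasRingHomProperty.iff_of_isAffine (P := @LocallyOfFiniteType)).mp inferInstance
    exact h1.comp (RingHom.FiniteType.of_surjective _
      (Scheme.ΓSpecIso (.of k)).symm.commRingCatIsoToRingEquiv.surjective)
  letI : Algebra k A := ψ.toAlgebra
  haveI hft : Algebra.FiniteType k A := hψ
  -- its fraction field `K`, and `X` as a projective model of `K/k`
  let K : Type := FractionRing A
  let j : Spec (.of A) ⟶ X := U.toScheme.isoSpec.inv ≫ U.ι
  have hj : j ≫ πX = Spec.map (CommRingCat.ofHom (algebraMap k A)) := by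
    change (U.toScheme.isoSpec.inv ≫ U.ι) ≫ πX = Spec.map (CommRingCat.ofHom ψ)
    rw [Category.assoc, isoSpec_inv_comp]
    rfl
  let M₀ : ProjModel k K := ProjModel.ofChart (K := K) X πX hproj A j hj
  -- `A` as a subalgebra `A₀ ⊆ K`, finitely generated with `Frac A₀ = K`
  let toK : A →ₐ[k] K := IsScalarTower.toAlgHom k A K
  let A₀ : Subalgebra k K := toK.range
  have hA₀fg : A₀.FG := by
    rw [show A₀ = Subalgebra.map toK ⊤ from (Algebra.map_top toK).symm]
    exact Subalgebra.FG.map toK hft.out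
  haveI hA₀fr : IsFractionRing A₀ K := by
    refine IsFractionRing.of_field A₀ K fun z => ?_
    obtain ⟨a, b, -, rfl⟩ := IsFractionRing.div_surjective (A := A) z
    exact ⟨⟨algebraMap A K a, a, rfl⟩, ⟨algebraMap A K b, b, rfl⟩, rfl⟩
  -- `trdeg_k K` is a natural number `m`
  haveI : Algebra.FiniteType k A₀ := A₀.fg_iff_finiteType.mp hA₀fg
  obtain ⟨m, -, htrA₀⟩ := exists_ringKrullDim_eq_and_trdeg_eq k A₀
  have hKm : Algebra.trdeg k K = m := (trdeg_eq_trdeg_of_isFractionRing A₀).trans htrA₀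
  -- a finite resolving system of affine models, from (LU)
  have hcov : ∀ v : ZariskiRiemannSpace k K, ∃ T : Subalgebra k K,
      (T.FG ∧ IsFractionRing T K) ∧ ZariskiRiemannSpace.HasRegularCentre T v :=
    fun v => exists_hasRegularCentre_of_relLU (hLU K) A₀ hA₀fg v
  obtain ⟨𝒯, h𝒯, h𝒯cov⟩ := exists_finite_resolvingSystem' (P := fun T => IsFractionRing T K)
    (fun T hT => (isJ2Ring_of_field k).2 T ((Subalgebra.fg_iff_finiteType T).mp hT)) hcov
  -- their projective closures, as PROPER models: a finite resolving system of proper models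
  have hM : ∀ T : ↥𝒯, ∃ M : ProperModel k K, ∀ w : ZariskiRiemannSpace k K,
      ZariskiRiemannSpace.HasRegularCentre T.1 w → M.RegCentre w := fun T => by
    haveI := (h𝒯 T.1 T.2).2
    obtain ⟨M, hM⟩ := ProjModel.exists_regCentre_of_hasRegularCentre T.1 (h𝒯 T.1 T.2).1
    exact ⟨M.toProperModel, fun w hw => (M.toProperModel_regCentre_iff w).mpr (hM w hw)⟩
  choose M hM using hM
  let l : List (ProperModel k K) := 𝒯.attach.toList.map M
  have hMl : ∀ T : ↥𝒯, M T ∈ l := fun T =>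
    List.mem_map.mpr ⟨T, Finset.mem_toList.mpr (Finset.mem_attach _ _), rfl⟩
  -- the iterated join of `M₀` with the resolving system, with CHOSEN dominations `φ T : N → M T`
  obtain ⟨N, φ₀, hN⟩ := exists_hom_forall_nonempty_hom M₀.toProperModel l
  let φ : (T : ↥𝒯) → N.Hom (M T) := fun T => (hN (M T) (hMl T)).some
  -- all members have dimension `m = trdeg_k K`
  have hdim : ∀ T : ↥𝒯, topologicalKrullDim (M T).X ≤ m := fun T =>
    (Pialt.OpenRange.properModel_topologicalKrullDim_eq_of_trdeg (M T) hKm).le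
  -- every point of `N` has a regular image on some member (valuation centres)
  have hgen : IsGenericPoint N.toKModel.genericPt (Set.univ : Set N.X) := by
    rw [N.genericPt_eq']
    exact genericPoint_spec N.X
  have hcovN : ∀ x : N.X, ∃ T : ↥𝒯,
      IsRegularLocalRing ((M T).X.presheaf.stalk ((φ T).f.base x)) := by
    intro x
    obtain ⟨v, hv⟩ := N.toKModel.exists_isCentre_of_isGenericPoint hgen x
    obtain ⟨T, hT, hTv⟩ := h𝒯cov v
    refine ⟨⟨T, hT⟩, ?_⟩
    have hx : (φ ⟨T, hT⟩).f.base x = (M ⟨T, hT⟩).centre v := by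
      rw [ProperModel.eq_centre_of_isCentre hv]
      exact (φ ⟨T, hT⟩).map_centre v
    rw [hx]
    exact hM ⟨T, hT⟩ v hTv
  -- the multi-roof gluing resolves `N`
  have hresN : Scheme.HasResolution N.X :=
    hR m N.X N.π (↥𝒯) (fun T => (M T).X) (fun T => (M T).π) hdim (fun T => (φ T).f)
      (fun T => (φ T).isBirational) hcovN
  -- transfer to `X = M₀.X` along the proper birational domination `N → M₀`
  have hres₀ : Scheme.HasResolution M₀.toProperModel.X :=
    Scheme.HasResolution.of_isBirational φ₀.f φ₀.isBirational hresN
  exact hres₀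

end PatchingPerfect.SliceAllDim

open PatchingPerfect.SliceAllDim in
/-- **STUB E3 `stub_sliceAllDim` — LU over `k` and the multi-roof gluing resolve every integral
variety over `k`, in every dimension** (registered signature verbatim). For a field `k` with
relative local uniformization over `k` (`hLU`, the antecedent of the crux at `k`) and the
multi-roof gluing over `k` (`hR`, stub E2), every integral separated `k`-scheme of finite type
`X` has a resolution of singularities. PROOF: (LU) reshaped fibrewise (a finitely generated
`R ⊆ O` with `Frac R = K` makes `K/k` finitely generated and puts `k` inside `O`); reduction to
integral closed subschemes of `ℙⁿ_k` (`ResolutionOverUpToDim.of_projective`, at any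
`d ≥ dim X`, `exists_topologicalKrullDim_le_of_locallyOfFiniteType`); then
`hasResolution_projective` (finite resolving system from LU, iterated join with chosen
dominations, valuation-centre covering, `hR`, birational transfer).
[cite: Zariski1944, p. 539] [cite: Piltant2013, Prop. 5.1 and Cor. 5.7] -/
theorem stub_sliceAllDim (k : Type) [Field k]
    (hLU : ∀ (K : Type) [Field K] [Algebra k K], (⊤ : IntermediateField k K).FG →
      ∀ O : ValuationSubring K, (∀ c : k, algebraMap k K c ∈ O) → ∀ R : Subalgebra k K, R.FG →
        R.toSubring ≤ O.toSubring → ∃ (A : Subalgebra k K) (h : A.toSubring ≤ O.toSubring),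
          R ≤ A ∧ A.FG ∧ IsFractionRing A K ∧ IsRegularLocalRing (Localization.AtPrime
            (Ideal.comap (Subring.inclusion h) (IsLocalRing.maximalIdeal O))))
    (hR : ∀ (d : ℕ) (N : Scheme.{0}) (gN : N ⟶ Spec (.of k)) [IsSeparated gN]
      [LocallyOfFiniteType gN] [QuasiCompact gN] [IsIntegral N] (ι : Type) [Finite ι]
      (N' : ι → Scheme.{0}) (g' : (i : ι) → (N' i ⟶ Spec (.of k)))
      [∀ i, LocallyOfFiniteType (g' i)] [∀ i, QuasiCompact (g' i)] [∀ i, IsIntegral (N' i)],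
      (∀ i, topologicalKrullDim (N' i) ≤ d) →
      ∀ (q : (i : ι) → (N ⟶ N' i)) [∀ i, IsProper (q i)], (∀ i, IsBirational (q i)) →
        (∀ n : N, ∃ i, IsRegularLocalRing ((N' i).presheaf.stalk ((q i).base n))) →
        Scheme.HasResolution N)
    (X : Scheme.{0}) (f : X ⟶ Spec (.of k)) [IsSeparated f] [LocallyOfFiniteType f]
    [QuasiCompact f] [IsIntegral X] : Scheme.HasResolution X := by
  -- (LU) at `k`, in the fibrewise shape
  have hLU' : ∀ (K : Type) [Field K] [Algebra k K] (O : ValuationSubring K) (R : Subalgebra k K),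
      R.FG → IsFractionRing R K → R.toSubring ≤ O.toSubring →
        ∃ (A : Subalgebra k K) (h : A.toSubring ≤ O.toSubring), R ≤ A ∧ A.FG ∧
          IsRegularLocalRing (Localization.AtPrime
            (Ideal.comap (Subring.inclusion h) (IsLocalRing.maximalIdeal O))) := by
    intro K _ _ O R hRfg hRfr hRO
    haveI : Algebra.FiniteType k R := R.fg_iff_finiteType.mp hRfg
    haveI : Algebra.EssFiniteType R K :=
      Algebra.EssFiniteType.of_isLocalization K (nonZeroDivisors R)
    have hKfg : (⊤ : IntermediateField k K).FG :=
      IntermediateField.fg_top_iff.mpr (Algebra.EssFiniteType.comp k R K)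
    obtain ⟨A, h, hle, hAfg, -, hreg⟩ :=
      hLU K hKfg O (fun c => hRO (R.algebraMap_mem c)) R hRfg hRO
    exact ⟨A, h, hle, hAfg, hreg⟩
  -- weak resolution over `k` up to every dimension `d`, by reduction to the projective case
  have hd : ∀ d : ℕ, ResolutionOverUpToDim k d := fun d =>
    ResolutionOverUpToDim.of_projective fun n Y ι hι hint _ => by
      haveI := hι
      haveI := hint
      exact hasResolution_projective hLU' hR Y ι
  -- `dim X` is finite
  haveI : CompactSpace X := QuasiCompact.compactSpace_of_compactSpace f
  obtain ⟨d, hXd⟩ := exists_topologicalKrullDim_le_of_locallyOfFiniteType f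
  exact hd d X f ‹_› ‹_› ‹_› inferInstance hXd

end Summit.ResolutionOfSingularities.ResolutionOfSingularities.Theorems

end
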